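import Mathlib.Analysis.Normed.Field.WithAbs
import Summits.ABC.IUTFork.Joshi.ArithHolStructureTiltAlgClosed
import Summits.ABC.IUTFork.Joshi.ArithHolStructureTiltCardinality
import HarnessLib

/-!
# [J-I] Def. 4.1.1 / Prop. 4.1.7 (1): the isometry binder on the tilting datum is NECESSARY — a kernel witness

Proof-and-model companion (abc-iut cell, block E «type Joshi's construction, test vs S», rung LADDER-ABC:A2.E; seat abc-iut-E-t10,
authors-first on its own lineage p431050/p437040 `Joshi/ArithHolStructure.lean`; source of record = the cell's PDF-paged render of
K. Joshi, *Construction of Arithmetic Teichmüller Spaces I*, arXiv:2106.11452 **v4**, bib `Joshi2021ATS1`).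

## What this file decides (our typing, not Joshi's text)
p431050 types [J-I] Def. 4.1.1 (p.18 l.11–22) as the record `ArithHolStructure X A F`: an untilt `K` (E-t1's `Untilt`), `E ↪ K`, the
tilting datum `tiltIso : K♭ ≃+* F` (a RING isomorphism of the concrete tilt `ATS1.tilt U` with the tilt base `F`), and — for §3.5's
clause «with an isometry K♭ ≃ F» (p.9 l.38–40) — a multiplicative map `sharp : F →*₀ K` with `norm_sharp : ‖sharp y‖ = ‖y‖`
(p431050 reading note (e): the agreement of `sharp` with Fontaine's `♯ ∘ tiltIso⁻¹` is NOT a field of the record). Its Prop. 4.1.7 (1)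
clauses (p.19 l.29–30 «characteristic zero, the same cardinality, the same residue fields and the same value groups as that of F») were
then decided by this lineage as: `charZero` PROVED (p431050), `SameCardinality` PROVED for every structure (p463093), `SameValueGroup` and
`SameResidueField` PROVED **modulo the reading binder** `h : ∀ y, ‖S.tiltIso y‖ = |y|_♭` («tiltIso is an isometry for the tilt norm»,
p433682/p442777/p446090/p463093 `prop417_one_of_tiltIso_isometry`; auditor aud-22 2026-08-26T19:47:14Z: «value-group + residue-field closers
carry ONLY the disclosed reading-binder h»).

THIS FILE shows the binder is NECESSARY for the value-group clause, i.e. the census word «DERIVED modulo h» is TIGHT: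

* §1 `TiltModel.TrivTilt U` — the tilt `K♭` carrying the TRIVIAL absolute value (Mathlib `WithAbs AbsoluteValue.trivial`): it fills ALL
  FIVE instance slots Def. 4.1.1 (1) puts on `F` — `NormedField` (Mathlib), `CompleteSpace` (`completeSpace_trivTilt`: Cauchy sequences are
  eventually constant), `IsUltrametricDist` (`isUltrametricDist_trivTilt`), `IsAlgClosed` (`isAlgClosed_trivTilt`, transported from p453124
  `isAlgClosed_tilt`), `CharP _ p` (`charP_trivTilt`, from p431050 `charP_tilt`).
* §2 `ArithHolStructure.trivialNormModel P` — for EVERY geometric base point `P : GeomBasePoint X A` (Def. 4.1.2) an inhabitant of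
  `ArithHolStructure X A (TrivTilt P.U)` with the SAME untilt, embedding and base point (`toGeomBasePoint_trivialNormModel`), tilting datum
  the identity transport `K♭ ≃+* (K♭, trivial)` and `sharp` the `{0,1}`-indicator monoid-with-zero hom (`indicatorHom`), which IS an isometry
  for the trivial norm (`norm_indicatorHom`) — so p431050's `sharp`/`norm_sharp` fields are satisfied WITHOUT pinning `F`'s norm to `|·|_♭`;
  and for it **`SameValueGroup` is FALSE** (`not_sameValueGroup_trivialNormModel`: `0 < ‖p‖_K < 1` is a norm value of `K` but the trivial
  norm takes only the values `0, 1`), while `charZero` and `SameCardinality` hold (as for every structure).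
* §3 the repair predicate BY NAME: `ArithHolStructure.TiltIsoIsometric S` := the binder `h` of record verbatim; under it all four clauses hold
  (`prop417_one_of_tiltIsoIsometric` = p463093), the trivial-norm inhabitant violates it (`not_tiltIsoIsometric_trivialNormModel`), the two
  facts together are the tightness certificate `sameValueGroup_modulo_tiltIsoIsometric_tight`; the binder HOLDS at the genuine-tilt models
  (`tiltIsoIsometric_ofTilt`, `tiltIsoIsometric_ofPadicComplexTilt` — the repaired record is inhabited, closed at `ℂ_p`), and the alternative
  link «`sharp` factors through `tiltIso` in norm» implies it (`tiltIsoIsometric_of_norm_sharp_eq`).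
* §4 closed instance: at `K := ℂ_p` (E-t1's `Untilt.padicComplex`), `E ↪ ℂ_p` (E-t1's `ATSObj.embPadicComplex`) and the trivial Berkovich datum
  (p458355 `BerkovichDatum.trivial`), for every tempered curve `X` (`exists_not_sameValueGroup_padicComplex`).

LOCATED (our side): the record `ArithHolStructure` as typed is WEAKER THAN PRINT on exactly the component reading note (e) flagged — the
value-group clause of Prop. 4.1.7 (1) is not a consequence of the typed Def. 4.1.1; the minimal repair is to carry `TiltIsoIsometric` (the
isometry read on `tiltIso` for `TiltModel.normedFieldTilt`, p442777) as a field, after which p463093 gives Prop. 4.1.7 (1) in full. The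
residue-field clause at the trivial-norm inhabitant is NOT decided here (its residue field is `K♭` itself; whether `k_K ≃+* K♭` depends on
`K` through cardinal invariants) and is not claimed either way. DEFS-FREEZE honoured (p431050 imported, not edited); no instance declared
(class slots are explicit terms, the lineage's `haveI` idiom); no FACT-LIST row, no Literature fact, no claim of Joshi's used as a
hypothesis or asserted. Typed ≠ proved ≠ endorsed; no side taken on [J-I], on [IUTchIII] Cor. 3.12 or on any author. bears_on: LADDER-ABC:A2.E.
-/

noncomputable section

open scoped NNReal
open Filter Topology

namespace Summit.ABC.IUTFork.Joshi.ATS1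

open Summit.ABC.IUTFork.Joshi Literature.AnabelianGeometry.SemiGraphs

variable {p : ℕ} [Fact p.Prime]

namespace TiltModel

/-! ## §1 The tilt `K♭` with the TRIVIAL absolute value: all five `F`-slots of Def. 4.1.1 (1) -/

open scoped Classical in
/-- The trivial absolute value on the tilt `K♭ = ATS1.tilt U` (`1` on every non-zero element). [folklore] -/
def trivialAbv (U : Untilt p) : AbsoluteValue (tilt U) ℝ := AbsoluteValue.trivial

/-- **`(K♭, |·|_triv)`**: the tilt carrying the trivial absolute value, as a Mathlib normed field (`WithAbs`). A type with the SAME field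
structure as `K♭` (`WithAbs.equiv`) and a norm that is NOT the tilt norm `|·|_♭`. [folklore] -/
abbrev TrivTilt (U : Untilt p) : Type := WithAbs (trivialAbv U)

open scoped Classical in
/-- The trivial absolute value, evaluated. [folklore] -/
theorem trivialAbv_apply (U : Untilt p) (x : tilt U) : trivialAbv U x = if x = 0 then 0 else 1 := rfl

/-- On `(K♭, |·|_triv)` every non-zero element has norm `1`. [folklore] -/
theorem norm_trivTilt_of_ne_zero {U : Untilt p} {x : TrivTilt U} (hx : x ≠ 0) : ‖x‖ = 1 := by
  rw [WithAbs.norm_eq_apply_ofAbs, trivialAbv_apply, if_neg (mt (WithAbs.ofAbs_eq_zero _).1 hx)]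

/-- … so every norm value is `0` or `1` … [folklore] -/
theorem norm_trivTilt_eq_zero_or_eq_one {U : Untilt p} (x : TrivTilt U) : ‖x‖ = 0 ∨ ‖x‖ = 1 := by
  by_cases hx : x = 0
  · exact Or.inl (by rw [hx, norm_zero])
  · exact Or.inr (norm_trivTilt_of_ne_zero hx)

/-- … and every norm is `≤ 1`. [folklore] -/
theorem norm_trivTilt_le_one {U : Untilt p} (x : TrivTilt U) : ‖x‖ ≤ 1 := by
  rcases norm_trivTilt_eq_zero_or_eq_one x with h | h <;> rw [h]
  exact zero_le_one

/-- The set of norm values of `(K♭, |·|_triv)` is `{0, 1}`. [folklore] -/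
theorem range_norm_trivTilt (U : Untilt p) : Set.range (fun y : TrivTilt U => ‖y‖) = {0, 1} := by
  ext t
  simp only [Set.mem_range, Set.mem_insert_iff, Set.mem_singleton_iff]
  constructor
  · rintro ⟨y, rfl⟩
    exact norm_trivTilt_eq_zero_or_eq_one y
  · rintro (rfl | rfl)
    · exact ⟨0, norm_zero⟩
    · exact ⟨1, norm_one⟩

/-- Slot `CompleteSpace F`: the trivially-normed field is complete (a Cauchy sequence is eventually constant). [folklore] -/
theorem completeSpace_trivTilt (U : Untilt p) : CompleteSpace (TrivTilt U) := by
  refine Metric.complete_of_cauchySeq_tendsto fun u hu => ?_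
  obtain ⟨N, hN⟩ := (Metric.cauchySeq_iff'.1 hu) 1 one_pos
  refine ⟨u N, tendsto_atTop_of_eventually_const (i₀ := N) fun n hn => ?_⟩
  by_contra hne
  have h1 : dist (u n) (u N) = 1 := by
    rw [dist_eq_norm]
    exact norm_trivTilt_of_ne_zero (sub_ne_zero.2 hne)
  exact absurd (hN n hn) (by rw [h1]; exact lt_irrefl 1)

/-- Slot `IsUltrametricDist F`: the trivial norm is ultrametric. [folklore] -/
theorem isUltrametricDist_trivTilt (U : Untilt p) : IsUltrametricDist (TrivTilt U) := by
  refine IsUltrametricDist.isUltrametricDist_of_forall_norm_add_le_max_norm fun x y => ?_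
  by_cases hx : x = 0
  · rw [hx, zero_add, norm_zero]
    exact le_max_of_le_right le_rfl
  · calc ‖x + y‖ ≤ 1 := norm_trivTilt_le_one _
      _ = ‖x‖ := (norm_trivTilt_of_ne_zero hx).symm
      _ ≤ max ‖x‖ ‖y‖ := le_max_left _ _

/-- Slot `IsAlgClosed F`: `(K♭, |·|_triv)` is algebraically closed — it IS `K♭` as a field (p453124 `isAlgClosed_tilt`, transported along
`WithAbs.equiv`). [folklore] -/
theorem isAlgClosed_trivTilt (U : Untilt p) : IsAlgClosed (TrivTilt U) :=
  haveI := isAlgClosed_tilt U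
  IsAlgClosed.of_ringEquiv (tilt U) (TrivTilt U) (WithAbs.equiv (trivialAbv U)).symm

/-- Slot `CharP F p`: `(K♭, |·|_triv)` has characteristic `p` (p431050 `charP_tilt`, transported). [folklore] -/
theorem charP_trivTilt (U : Untilt p) : CharP (TrivTilt U) p :=
  haveI := charP_tilt U
  charP_of_injective_ringHom (f := (WithAbs.equiv (trivialAbv U)).symm.toRingHom) (WithAbs.equiv (trivialAbv U)).symm.injective p

/-- All five classes Def. 4.1.1 (1) puts on the tilt base `F`, at `F := (K♭, |·|_triv)` — cf. p458355 `tilt_slots_all` for the genuine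
`(K♭, |·|_♭)`. [folklore] -/
theorem trivTilt_slots_all (U : Untilt p) :
    CompleteSpace (TrivTilt U) ∧ IsUltrametricDist (TrivTilt U) ∧ IsAlgClosed (TrivTilt U) ∧ CharP (TrivTilt U) p :=
  ⟨completeSpace_trivTilt U, isUltrametricDist_trivTilt U, isAlgClosed_trivTilt U, charP_trivTilt U⟩

/-- But `(K♭, |·|_triv)` does NOT have «the same value group» as `K`: `‖p‖_K ∈ (0, 1)` is a norm value of `K` and not of the trivial norm.
[folklore] -/
theorem range_norm_K_ne_range_norm_trivTilt (U : Untilt p) :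
    Set.range (fun x : U.K => ‖x‖) ≠ Set.range (fun y : TrivTilt U => ‖y‖) := by
  intro h
  obtain ⟨y, hy⟩ : ‖(p : U.K)‖ ∈ Set.range (fun y : TrivTilt U => ‖y‖) := h ▸ ⟨(p : U.K), rfl⟩
  have h0 : 0 < ‖(p : U.K)‖ := norm_pos_iff.2 (Nat.cast_ne_zero.2 (Fact.out : p.Prime).ne_zero)
  have h1 : ‖(p : U.K)‖ < 1 := U.norm_p_lt_one
  rcases norm_trivTilt_eq_zero_or_eq_one y with h' | h'
  · exact absurd (hy.symm.trans h') h0.ne'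
  · exact absurd (hy.symm.trans h') h1.ne

end TiltModel

namespace ArithHolStructure

open TiltModel

variable {X : TemperedCurve p} {A : BerkovichDatum X}

/-! ## §2 The trivial-norm inhabitant of the typed Def. 4.1.1 record, over any geometric base point -/

open scoped Classical in
/-- The `{0,1}`-INDICATOR monoid-with-zero hom `(K♭, |·|_triv) →*₀ K`: `0 ↦ 0`, everything else `↦ 1` (multiplicative because a field has no
zero-divisors). It is what p431050's field `sharp : F →*₀ K` is allowed to be when `F`'s norm is not pinned to `|·|_♭`. [folklore] -/
def indicatorHom (U : Untilt p) : TrivTilt U →*₀ U.K where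
  toFun y := if y = 0 then 0 else 1
  map_zero' := if_pos rfl
  map_one' := if_neg one_ne_zero
  map_mul' y z := by
    by_cases hy : y = 0
    · simp only [hy, zero_mul, if_true]
    by_cases hz : z = 0
    · simp only [hz, mul_zero, if_true]
    simp only [mul_ne_zero hy hz, hy, hz, if_false, mul_one]

open scoped Classical in
/-- The indicator hom, evaluated. [folklore] -/
theorem indicatorHom_apply (U : Untilt p) (y : TrivTilt U) : indicatorHom U y = if y = 0 then 0 else 1 := rfl

/-- The indicator hom IS an isometry for the trivial norm: `‖indicatorHom y‖_K = ‖y‖_triv` — p431050's `norm_sharp` holds for it. [folklore] -/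
theorem norm_indicatorHom (U : Untilt p) (y : TrivTilt U) : ‖indicatorHom U y‖ = ‖y‖ := by
  rw [indicatorHom_apply]
  by_cases hy : y = 0
  · rw [if_pos hy, hy, norm_zero, norm_zero]
  · rw [if_neg hy, norm_one, norm_trivTilt_of_ne_zero hy]

/-- **THE TRIVIAL-NORM INHABITANT.** For every geometric base point `P = (K, E ↪ K, ∗_K)` (Def. 4.1.2, p431050 `GeomBasePoint`), the typed
Def. 4.1.1 record over the tilt base `F := (K♭, |·|_triv)` — same untilt, embedding and base point; tilting datum the identity transport
`K♭ ≃+* (K♭, |·|_triv)` (`WithAbs.equiv`); `sharp` the indicator hom. Every field of p431050's `ArithHolStructure` is satisfied, all five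
instance slots supplied by §1's hypothesis-free terms. CONSTRUCTED (a test object for OUR typing; no claim that Joshi's Def. 4.1.1 admits
it — print's «with an isometry K♭ ≃ F» excludes it, which is the point). [folklore] -/
def trivialNormModel (P : GeomBasePoint X A) :
    haveI := completeSpace_trivTilt P.U
    haveI := isUltrametricDist_trivTilt P.U
    haveI := isAlgClosed_trivTilt P.U
    haveI := charP_trivTilt P.U
    ArithHolStructure X A (TrivTilt P.U) :=
  haveI := completeSpace_trivTilt P.U
  haveI := isUltrametricDist_trivTilt P.U
  haveI := isAlgClosed_trivTilt P.U
  haveI := charP_trivTilt P.U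
  { U := P.U
    emb := P.emb
    continuous_emb := P.continuous_emb
    tiltIso := (WithAbs.equiv (trivialAbv P.U)).symm
    sharp := indicatorHom P.U
    norm_sharp := norm_indicatorHom P.U
    basePt := P.pt }

/-- Its untilt is `P`'s `K`. [folklore] -/
theorem trivialNormModel_U (P : GeomBasePoint X A) :
    haveI := completeSpace_trivTilt P.U
    haveI := isUltrametricDist_trivTilt P.U
    haveI := isAlgClosed_trivTilt P.U
    haveI := charP_trivTilt P.U
    (trivialNormModel P).U = P.U := rfl

/-- Its geometric base point (Lem. 4.1.4, p431050 `toGeomBasePoint`) is `P` itself — the inhabitant extends EVERY base point. [folklore] -/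
theorem toGeomBasePoint_trivialNormModel (P : GeomBasePoint X A) :
    haveI := completeSpace_trivTilt P.U
    haveI := isUltrametricDist_trivTilt P.U
    haveI := isAlgClosed_trivTilt P.U
    haveI := charP_trivTilt P.U
    (trivialNormModel P).toGeomBasePoint = P := by
  cases P
  rfl

/-- **Prop. 4.1.7 (1)'s value-group clause FAILS at the trivial-norm inhabitant**: `¬ SameValueGroup` (p431050's concrete typing
`range ‖·‖_K = range ‖·‖_F`). So the clause is NOT a consequence of the Def. 4.1.1 record as typed in p431050. [folklore] -/
theorem not_sameValueGroup_trivialNormModel (P : GeomBasePoint X A) :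
    haveI := completeSpace_trivTilt P.U
    haveI := isUltrametricDist_trivTilt P.U
    haveI := isAlgClosed_trivTilt P.U
    haveI := charP_trivTilt P.U
    ¬ (trivialNormModel P).SameValueGroup :=
  range_norm_K_ne_range_norm_trivTilt P.U

/-- … while the characteristic-zero and cardinality clauses HOLD there (as for every structure: p431050 `charZero`, p463093
`sameCardinality`) — exactly the value-group clause separates. [folklore] -/
theorem charZero_sameCardinality_trivialNormModel (P : GeomBasePoint X A) :
    haveI := completeSpace_trivTilt P.U
    haveI := isUltrametricDist_trivTilt P.U
    haveI := isAlgClosed_trivTilt P.U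
    haveI := charP_trivTilt P.U
    CharZero (trivialNormModel P).U.K ∧ (trivialNormModel P).SameCardinality :=
  haveI := completeSpace_trivTilt P.U
  haveI := isUltrametricDist_trivTilt P.U
  haveI := isAlgClosed_trivTilt P.U
  haveI := charP_trivTilt P.U
  ⟨(trivialNormModel P).charZero, (trivialNormModel P).sameCardinality⟩

/-! ## §3 The repair predicate, by name; tightness of «DERIVED modulo h» -/

variable {F : Type} [NormedField F] [CompleteSpace F] [IsUltrametricDist F] [IsAlgClosed F] [CharP F p]

/-- **The reading binder `h` of record, as a predicate on the typed structure**: the tilting datum `tiltIso : K♭ ≃+* F` is an ISOMETRY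
for the tilt norm `|·|_♭` (p442777 `TiltModel.normedFieldTilt`) — [J-I] §3.5 p.9 l.38–40 «with an isometry K♭ ≃ F», Def. 4.1.1 (1)
p.18 l.11–22 «a choice of an untilt (K ⊃ E, K♭ ≃ F)», read on the structure's OWN `tiltIso`. Verbatim the hypothesis of p463093
`prop417_one_of_tiltIso_isometry` / p446090 `sameResidueField_of_tiltIso_isometry`. A READING of print (the field the record should carry);
never asserted. [claim: Joshi2021ATS1, status: disputed] -/
@[claim "Joshi2021ATS1" "disputed"]
def TiltIsoIsometric (S : ArithHolStructure X A F) : Prop := ∀ y, ‖S.tiltIso y‖ = (letI := normedFieldTilt S.U; ‖y‖)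

/-- Under the binder ALL FOUR clauses of Prop. 4.1.7 (1) hold (p463093 `prop417_one_of_tiltIso_isometry`, by name). [claim: Joshi2021ATS1, status: disputed] -/
theorem prop417_one_of_tiltIsoIsometric (S : ArithHolStructure X A F) (h : S.TiltIsoIsometric) :
    CharZero S.U.K ∧ S.SameCardinality ∧ S.SameValueGroup ∧ S.SameResidueField :=
  prop417_one_of_tiltIso_isometry S h

/-- The trivial-norm inhabitant VIOLATES the binder (else its value-group clause would hold). [folklore] -/
theorem not_tiltIsoIsometric_trivialNormModel (P : GeomBasePoint X A) :
    haveI := completeSpace_trivTilt P.U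
    haveI := isUltrametricDist_trivTilt P.U
    haveI := isAlgClosed_trivTilt P.U
    haveI := charP_trivTilt P.U
    ¬ (trivialNormModel P).TiltIsoIsometric :=
  haveI := completeSpace_trivTilt P.U
  haveI := isUltrametricDist_trivTilt P.U
  haveI := isAlgClosed_trivTilt P.U
  haveI := charP_trivTilt P.U
  fun h => not_sameValueGroup_trivialNormModel P (prop417_one_of_tiltIsoIsometric _ h).2.2.1

/-- Directly: `‖p♭‖`-style witness-free form — the binder fails at the trivial-norm inhabitant because the identity transport carries an
element of tilt-norm `∉ {0,1}` (namely any `y` with `|y|_♭ = ‖p‖_K`, which exists by p442777 `range_norm_tilt_eq`) to an element of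
trivial norm `1`. [folklore] -/
theorem exists_tiltIso_not_isometric_trivialNormModel (P : GeomBasePoint X A) :
    haveI := completeSpace_trivTilt P.U
    haveI := isUltrametricDist_trivTilt P.U
    haveI := isAlgClosed_trivTilt P.U
    haveI := charP_trivTilt P.U
    ∃ y : tilt P.U, ‖(trivialNormModel P).tiltIso y‖ ≠ (letI := normedFieldTilt P.U; ‖y‖) := by
  haveI := completeSpace_trivTilt P.U
  haveI := isUltrametricDist_trivTilt P.U
  haveI := isAlgClosed_trivTilt P.U
  haveI := charP_trivTilt P.U
  by_contra hall
  push Not at hall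
  exact not_tiltIsoIsometric_trivialNormModel P hall

/-- **TIGHTNESS CERTIFICATE for the census word «Prop. 4.1.7 (1) value groups: DERIVED modulo h».** (i) modulo the binder the clause holds
for every structure over every tilt base (p433682/p442777); (ii) without it, every geometric base point extends to a typed structure — over
the admissible tilt base `(K♭, |·|_triv)` — at which the clause FAILS. [folklore] -/
theorem sameValueGroup_modulo_tiltIsoIsometric_tight :
    (∀ S : ArithHolStructure X A F, S.TiltIsoIsometric → S.SameValueGroup) ∧
    (∀ P : GeomBasePoint X A,
      haveI := completeSpace_trivTilt P.U
      haveI := isUltrametricDist_trivTilt P.U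
      haveI := isAlgClosed_trivTilt P.U
      haveI := charP_trivTilt P.U
      (trivialNormModel P).toGeomBasePoint = P ∧ ¬ (trivialNormModel P).TiltIsoIsometric ∧ ¬ (trivialNormModel P).SameValueGroup) :=
  ⟨fun S h => (prop417_one_of_tiltIsoIsometric S h).2.2.1,
    fun P => ⟨toGeomBasePoint_trivialNormModel P, not_tiltIsoIsometric_trivialNormModel P, not_sameValueGroup_trivialNormModel P⟩⟩

/-- Conversely the binder HOLDS at the lineage's GENUINE-TILT models (p453124 `ofTilt`: tilt base `(K♭, |·|_♭)`, tilting datum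
`RingEquiv.refl`) — so the REPAIRED record «Def. 4.1.1 as typed + `TiltIsoIsometric`» is inhabited over every untilt and base point
(non-vacuity of the repair). [folklore] -/
theorem tiltIsoIsometric_ofTilt (U : Untilt p) (emb : X.K →+* U.K) (h : Continuous fun x : ℚ_[p] => emb (algebraMap ℚ_[p] X.K x))
    (b : A.BasePt U emb) :
    letI := normedFieldTilt U
    haveI := completeSpace_tilt U
    haveI := isUltrametricDist_tilt U
    haveI := isAlgClosed_normedFieldTilt U
    haveI := charP_normedFieldTilt U
    (ofTilt U emb h b).TiltIsoIsometric :=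
  fun _ => rfl

/-- … in particular at the closed term p458355 `ofPadicComplexTilt X` (`K := ℂ_p`, `F := (ℂ_p♭, |·|_♭)`), for every tempered curve `X`:
the repaired record has a CLOSED inhabitant, with all four Prop. 4.1.7 (1) clauses (`prop417_one_of_tiltIsoIsometric`). [folklore] -/
theorem tiltIsoIsometric_ofPadicComplexTilt (X : TemperedCurve p) :
    letI := normedFieldTilt (Untilt.padicComplex p)
    haveI := completeSpace_tilt (Untilt.padicComplex p)
    haveI := isUltrametricDist_tilt (Untilt.padicComplex p)
    haveI := isAlgClosed_normedFieldTilt (Untilt.padicComplex p)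
    haveI := charP_normedFieldTilt (Untilt.padicComplex p)
    (ofPadicComplexTilt X).TiltIsoIsometric ∧ CharZero (ofPadicComplexTilt X).U.K ∧ (ofPadicComplexTilt X).SameCardinality ∧
      (ofPadicComplexTilt X).SameValueGroup ∧ (ofPadicComplexTilt X).SameResidueField :=
  letI := normedFieldTilt (Untilt.padicComplex p)
  haveI := completeSpace_tilt (Untilt.padicComplex p)
  haveI := isUltrametricDist_tilt (Untilt.padicComplex p)
  haveI := isAlgClosed_normedFieldTilt (Untilt.padicComplex p)
  haveI := charP_normedFieldTilt (Untilt.padicComplex p)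
  have h : (ofPadicComplexTilt X).TiltIsoIsometric := fun _ => rfl
  ⟨h, prop417_one_of_tiltIsoIsometric _ h⟩

/-- The ALTERNATIVE repair, read on p431050's own fields: if the posited `sharp : F →*₀ K` is tied to the tilting datum by
`‖sharp y‖_K = |tiltIso⁻¹ y|_♭` (reading note (e)'s «agreement of `sharp` with `♯ ∘ ι⁻¹`», in norm), then `norm_sharp` forces the binder —
so EITHER link (isometric `tiltIso`, or `sharp` factoring through it in norm) repairs the record. [folklore] -/
theorem tiltIsoIsometric_of_norm_sharp_eq (S : ArithHolStructure X A F)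
    (hsh : ∀ y : F, ‖S.sharp y‖ = (letI := normedFieldTilt S.U; ‖S.tiltIso.symm y‖)) : S.TiltIsoIsometric := by
  intro y
  rw [← S.norm_sharp (S.tiltIso y), hsh, RingEquiv.symm_apply_apply]

/-! ## §4 A closed instance: `K := ℂ_p`, the trivial Berkovich datum, every tempered curve `X` -/

/-- The geometric base point `(ℂ_p, E ↪ ℂ_p, ∗)` over the trivial Berkovich datum (E-t1's `Untilt.padicComplex`, `ATSObj.embPadicComplex`;
p458355 `BerkovichDatum.trivial`). [folklore] -/
def GeomBasePoint.padicComplexTrivial (X : TemperedCurve p) : GeomBasePoint X (BerkovichDatum.trivial X) :=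
  ⟨Untilt.padicComplex p, ATSObj.embPadicComplex X, ATSObj.continuous_embPadicComplex X, PUnit.unit⟩

/-- **Closed witness, for every tempered curve `X/E`**: over the tilt base `(ℂ_p♭, |·|_triv)` and the trivial Berkovich datum there is a typed
arithmetic holomorphic structure with untilt `ℂ_p` whose characteristic-zero and cardinality clauses hold and whose VALUE-GROUP clause and
isometry binder FAIL. Compare p458355 `nonempty_padicComplexTilt` (the genuine `(ℂ_p♭, |·|_♭)`, where both Prop. 4.1.7 (1) clauses hold).
[folklore] -/
theorem exists_not_sameValueGroup_padicComplex (X : TemperedCurve p) :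
    haveI := completeSpace_trivTilt (Untilt.padicComplex p)
    haveI := isUltrametricDist_trivTilt (Untilt.padicComplex p)
    haveI := isAlgClosed_trivTilt (Untilt.padicComplex p)
    haveI := charP_trivTilt (Untilt.padicComplex p)
    ∃ S : ArithHolStructure X (BerkovichDatum.trivial X) (TrivTilt (Untilt.padicComplex p)),
      S.U = Untilt.padicComplex p ∧ CharZero S.U.K ∧ S.SameCardinality ∧ ¬ S.SameValueGroup ∧ ¬ S.TiltIsoIsometric :=
  haveI := completeSpace_trivTilt (Untilt.padicComplex p)
  haveI := isUltrametricDist_trivTilt (Untilt.padicComplex p)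
  haveI := isAlgClosed_trivTilt (Untilt.padicComplex p)
  haveI := charP_trivTilt (Untilt.padicComplex p)
  ⟨trivialNormModel (GeomBasePoint.padicComplexTrivial X), rfl,
    (charZero_sameCardinality_trivialNormModel _).1, (charZero_sameCardinality_trivialNormModel _).2,
    not_sameValueGroup_trivialNormModel _, not_tiltIsoIsometric_trivialNormModel _⟩

end ArithHolStructure

end Summit.ABC.IUTFork.Joshi.ATS1

end
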